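import Literature.AlgebraicTopology.CharacteristicClasses.LineCocycleChernClass
import Literature.AlgebraicGeometry.HodgeTheory.GAGALineBundlesProofs
import Literature.AlgebraicGeometry.Modules.PullbackFrame
import Literature.AlgebraicGeometry.Modules.DetClassOfIso
import Literature.AlgebraicGeometry.Modules.LineBundleOfCocycleClass
import Literature.AlgebraicGeometry.KTheory.PullbackVectorBundle
import HarnessLib

/-!
# The topological first Chern class of an algebraic line bundle on the complex points

Family `hodge`, layer `Literature/AlgebraicGeometry/HodgeTheory`, namespace `Literature.AlgebraicGeometry.HodgeTheory` (dot-notation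
extensions of `Modules.UnitCocycle`, `Modules.CechPic`, `Geometry.Kaehler.HolomorphicLineBundle`).  For a scheme `X` over `ℂ`, an
algebraic line bundle given by a Čech cocycle of units `g_{xy} ∈ Γ(U_x ∩ U_y, 𝒪_X^×)` on a Zariski cover (★ `Modules.UnitCocycle`,
Hartshorne III Ex. 4.5 `Pic X = Ȟ¹(X, 𝒪_X^×)`) defines, on the complex points `X(ℂ)` with the analytic topology, the CONTINUOUS
line cocycle `P ↦ g_{yx}(P)` on the open cover `U_x(ℂ)` (Serre, GAGA §2 n° 6 / §4 n° 20: «tout espace fibré algébrique `E` définit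
un espace fibré analytique `E^h`»; regular functions are continuous on `X(ℂ)`), i.e. a Mathlib `VectorBundleCore ℂ X(ℂ) ℂ X`, and
hence (★ `CharacteristicClasses.lineChernClass`) a TOPOLOGICAL first Chern class in `H²(X(ℂ); ℤ)` when `X(ℂ)` is Hausdorff and
paracompact.  This file proves that this class is an invariant of the line bundle, natural under pull-back:

* `UnitCocycle.complexCore c` — the continuous line cocycle of `c` on `X(ℂ)` (index = points of `X`, `indexAt P = P.pt`; transition
  `coordChange x y P = g_{yx}(P) •`, the frame convention of ★ `HodgeTheory.cartierDivisorLineBundle`: the coordinate in the chart `U_y`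
  is `g_{yx}` times the coordinate in the chart `U_x`), and **`UnitCocycle.topChernClass c : H²(X(ℂ); ℤ)`**;
* **`UnitCocycle.topChernClass_eq_of_coboundary`** — cohomologous unit cocycles (★ `UnitCocycle.Coboundary`: common point-indexed
  refinement `W_x`, units `λ_x` with `g′_{xy} λ_y = λ_x g_{xy}`) have the same class (★ `lineChernClass_eq_of_refinement` +
  ★ `lineChernClass_eq_of_cohomologous` with `h_x = λ_x(P)`), so that the class descends to **`CechPic.topChernClass : Ȟ¹(X, 𝒪_X^×) →
  H²(X(ℂ); ℤ)`** (`CechPic.topChernClass_mk`);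
* **`Modules.detTopChernClass hE`** for a finite locally free `𝒪_X`-module `E` := the class of ★ `detClass hE` (= `c₁(det E)`; for a LINE
  bundle, `c₁(E)`), computed in ANY frame system (`detTopChernClass_eq_of_frameSystem`, ★ `detClass_eq_mk`), independent of the
  local-freeness witness, invariant under isomorphism (`detTopChernClass_eq_of_iso`, ★ `detClass_eq_of_iso`), and equal to
  `c.topChernClass` on the line bundle glued from `c` (`detTopChernClass_lineBundle`, ★ `detClass_lineBundle`);
* NATURALITY **`UnitCocycle.topChernClass_pullback`** / `CechPic.topChernClass_pullback` / **`Modules.detTopChernClass_pullback`**: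
  `c₁(f^*E) = H²(f(ℂ)) c₁(E)` for EVERY morphism `f : Y ⟶ X` of `ℂ`-schemes (no dominance hypothesis) — the cocycle `f^♯ g_{f y′, f y}`
  of ★ `UnitCocycle.pullback` read at `Q ∈ Y(ℂ)` is `g` read at `f(Q)` (★ `evalOrZero_appLE`), a refinement (index map `f`) of the induced
  cocycle ★ `VectorBundleCore.pullbackCore`, then ★ `lineChernClass_pullbackCore` + ★ `detClass_pullback`;
* the junction with the analytic side: `HolomorphicLineBundle.toCore` (a holomorphic line cocycle on a complex manifold as a continuous
  `VectorBundleCore`) and **`lineChernClass_toCore_cartierDivisorLineBundle`**: for an analytification `φ : M → X(ℂ)` and a Cartier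
  divisor `D`, `c₁((𝒪_X(D)^an).toCore) = H²(φ) (D.toUnitCocycle.topChernClass)` — the class the torus-side computation of the cell
  `hodgecm-mathlib` (U)-lane (T3) starts from.

Everything is proved; no named fact, no instance, no notation.  Cell pointer: node U-e, road (T-top), leaf (T2) item (L5) (P4 lead
B-p03 (g13) nod 15:00:57Z); HC_CM is proved only modulo the 7 printed citations until rung 0 closes, and this file discharges none.

## References
* [SerreGAGA1956] J.-P. Serre, *Géométrie algébrique et géométrie analytique*, Ann. Inst. Fourier 6 (1956), §2 n° 6, §4 n° 20.
* [Hartshorne1977] R. Hartshorne, *Algebraic Geometry* (1977), III Ex. 4.5 (`Pic X ≅ Ȟ¹(X, 𝒪_X^×)`), II Ex. 6.8 (a) (`f^*` on `Pic`).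
* [HusemollerFibreBundles1994] D. Husemoller, *Fibre Bundles*, 3rd ed. (1994), Ch. 5 §3 (Thm. 3.2, Prop. 3.3, Prop. 3.5), Ch. 17 Prop. 3.3.
* [GortzWedhorn2020] U. Görtz, T. Wedhorn, *Algebraic Geometry I*, 2nd ed. (2020), (11.9), Prop. 11.21 (p. 302).
* [VoisinHodgeI2002] C. Voisin, *Hodge Theory and Complex Algebraic Geometry I* (2002), §3.3.1, Thm. 4.49, Thm. 11.33.
-/

set_option autoImplicit false

noncomputable section

open CategoryTheory AlgebraicGeometry TopologicalSpace Opposite Bundle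
open Literature.AlgebraicGeometry.Motives Literature.AlgebraicGeometry.Motives.AlgPoints
open Literature.AlgebraicGeometry.Modules
open Literature.AlgebraicTopology.CharacteristicClasses Literature.AlgebraicTopology.SingularHomology

namespace Literature.AlgebraicGeometry.HodgeTheory

/-! ### §1 The continuous line cocycle of a unit cocycle on `X(ℂ)` -/

section ComplexCore

variable {X : SchemeOver ℂ} (c : UnitCocycle X.left)

/-- **The continuous line cocycle `E^h` of an algebraic unit cocycle on the complex points**: charts `U_x(ℂ)` indexed by the points
of `X` (`indexAt P = P.pt`), transition `v ↦ g_{yx}(P) • v` from the chart `U_x` to the chart `U_y` (regular functions are continuous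
on `X(ℂ)`, ★ `AlgPoints.continuousOn_evalOrZero`; the cocycle identities are ★ `UnitCocycle.evalOrZero_gInf_mul/_self`).
A deliberate dot-notation extension of `Modules.UnitCocycle`. [cite: SerreGAGA1956, §2 n°6 and §4 n°20] -/
def _root_.Literature.AlgebraicGeometry.Modules.UnitCocycle.complexCore :
    VectorBundleCore ℂ (ComplexPoints X) ℂ X.left where
  baseSet x := {P | P.pt ∈ c.U x}
  isOpen_baseSet x := AlgPoints.isOpen_setOf_pt_mem (c.U x)
  indexAt P := P.pt
  mem_baseSet_at P := c.mem P.pt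
  coordChange x y P := ContinuousLinearMap.lsmul ℂ ℂ (evalOrZero (c.U y ⊓ c.U x) (c.gInf y x) P)
  coordChange_self x P hP v := by
    rw [ContinuousLinearMap.lsmul_apply, c.evalOrZero_gInf_self hP, one_smul]
  continuousOn_coordChange x y :=
    (ContinuousLinearMap.lsmul ℂ ℂ).continuous.comp_continuousOn
      ((continuousOn_evalOrZero (c.U y ⊓ c.U x) (c.gInf y x)).mono fun _ hP ↦ ⟨hP.2, hP.1⟩)
  coordChange_comp x y z P hP v := by
    rw [ContinuousLinearMap.lsmul_apply, ContinuousLinearMap.lsmul_apply, ContinuousLinearMap.lsmul_apply, smul_smul,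
      c.evalOrZero_gInf_mul hP.2 hP.1.2 hP.1.1]

/-- The charts of `E^h` (definitional). [cite: SerreGAGA1956, §4 n°20] -/
@[simp]
theorem _root_.Literature.AlgebraicGeometry.Modules.UnitCocycle.complexCore_baseSet (x : X.left) :
    c.complexCore.baseSet x = {P | P.pt ∈ c.U x} := rfl

/-- The distinguished chart at `P` is `U_{P.pt}` (definitional). [cite: SerreGAGA1956, §4 n°20] -/
@[simp]
theorem _root_.Literature.AlgebraicGeometry.Modules.UnitCocycle.complexCore_indexAt (P : ComplexPoints X) :
    c.complexCore.indexAt P = P.pt := rfl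

/-- The transition maps of `E^h`: multiplication by `g_{yx}(P)`. [cite: SerreGAGA1956, §4 n°20] -/
@[simp]
theorem _root_.Literature.AlgebraicGeometry.Modules.UnitCocycle.complexCore_coordChange_apply (x y : X.left) (P : ComplexPoints X)
    (v : ℂ) : c.complexCore.coordChange x y P v = evalOrZero (c.U y ⊓ c.U x) (c.gInf y x) P * v := rfl

variable [T2Space (ComplexPoints X)] [ParacompactSpace (ComplexPoints X)]

/-- **The topological first Chern class `c₁(E^h) ∈ H²(X(ℂ); ℤ)` of the algebraic line bundle of a unit cocycle** (for `X(ℂ)` Hausdorff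
and paracompact): ★ `lineChernClass` of `complexCore`. A deliberate dot-notation extension of `Modules.UnitCocycle`.
[cite: HusemollerFibreBundles1994, Ch. 17 Def. 2.6] [cite: SerreGAGA1956, §4 n°20] -/
def _root_.Literature.AlgebraicGeometry.Modules.UnitCocycle.topChernClass :
    singularCohomology ℤ ℤ (ComplexPoints X) 2 :=
  lineChernClass c.complexCore

/-- Unfolding. [cite: HusemollerFibreBundles1994, Ch. 17 Def. 2.6] -/
theorem _root_.Literature.AlgebraicGeometry.Modules.UnitCocycle.topChernClass_eq :
    c.topChernClass = lineChernClass c.complexCore := rfl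

end ComplexCore

/-! ### §2 Cohomologous unit cocycles have the same class; the class on `Ȟ¹(X, 𝒪_X^×)` -/

section Coboundary

variable {X : SchemeOver ℂ} {c c' : UnitCocycle X.left}

/-- The cocycle of `c` restricted to the refining cover `W_x ≤ U_x` of a coboundary (same index at every point, same transition
functions). [cite: Hartshorne1977, III Ex. 4.5] -/
def coboundaryCore (b : UnitCocycle.Coboundary c c') : VectorBundleCore ℂ (ComplexPoints X) ℂ X.left where
  baseSet x := {P | P.pt ∈ b.W x}
  isOpen_baseSet x := AlgPoints.isOpen_setOf_pt_mem (b.W x)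
  indexAt P := P.pt
  mem_baseSet_at P := b.mem P.pt
  coordChange := c.complexCore.coordChange
  coordChange_self x P hP v := c.complexCore.coordChange_self x P (b.le x hP) v
  continuousOn_coordChange x y :=
    (c.complexCore.continuousOn_coordChange x y).mono fun _ hP ↦ ⟨b.le x hP.1, b.le y hP.2⟩
  coordChange_comp x y z P hP v := c.complexCore.coordChange_comp x y z P ⟨⟨b.le x hP.1.1, b.le y hP.1.2⟩, b.le z hP.2⟩ v

/-- The unit `λ_x` of a coboundary does not vanish at the complex points of `W_x` (`λ_x λ_x⁻¹ = 1` read at `P`).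
[cite: Hartshorne1977, III Ex. 4.5] -/
theorem evalOrZero_lam_ne_zero (b : UnitCocycle.Coboundary c c') (x : X.left) {P : ComplexPoints X} (hP : P.pt ∈ b.W x) :
    evalOrZero (b.W x) (b.lam x (b.W x) le_rfl) P ≠ 0 := by
  have h := congrArg (fun s ↦ evalOrZero (b.W x) s P) (b.lam_mul_inv x (b.W x) le_rfl)
  simp only [evalOrZero_mul_apply, evalOrZero_one hP] at h
  exact left_ne_zero_of_mul_eq_one h

/-- The coboundary relation read at a complex point of `W_x ∩ W_y`: `g′_{yx}(P) λ_x(P) = λ_y(P) g_{yx}(P)`.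
[cite: Hartshorne1977, III Ex. 4.5] -/
theorem evalOrZero_coboundary_rel (b : UnitCocycle.Coboundary c c') (x y : X.left) {P : ComplexPoints X}
    (hx : P.pt ∈ b.W x) (hy : P.pt ∈ b.W y) :
    evalOrZero (c'.U y ⊓ c'.U x) (c'.gInf y x) P * evalOrZero (b.W x) (b.lam x (b.W x) le_rfl) P =
      evalOrZero (b.W y) (b.lam y (b.W y) le_rfl) P * evalOrZero (c.U y ⊓ c.U x) (c.gInf y x) P := by
  set V : X.left.Opens := b.W y ⊓ b.W x with hV
  have hPV : P.pt ∈ V := ⟨hy, hx⟩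
  have hrel := congrArg (fun s ↦ evalOrZero V s P) (b.rel y x V inf_le_left inf_le_right)
  simp only [evalOrZero_mul_apply] at hrel
  -- restrict every factor from its natural open to `V`
  have e₁ : c'.g y x V (inf_le_left.trans (b.le' y)) (inf_le_right.trans (b.le' x)) =
      X.left.presheaf.map (homOfLE (le_inf (inf_le_left.trans (b.le' y)) (inf_le_right.trans (b.le' x)))).op (c'.gInf y x) :=
    (c'.map_g y x inf_le_left inf_le_right _).symm
  have e₂ : c.g y x V (inf_le_left.trans (b.le y)) (inf_le_right.trans (b.le x)) =
      X.left.presheaf.map (homOfLE (le_inf (inf_le_left.trans (b.le y)) (inf_le_right.trans (b.le x)))).op (c.gInf y x) :=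
    (c.map_g y x inf_le_left inf_le_right _).symm
  have e₃ : b.lam x V inf_le_right = X.left.presheaf.map (homOfLE (inf_le_right : V ≤ b.W x)).op (b.lam x (b.W x) le_rfl) :=
    (b.map_lam x le_rfl inf_le_right).symm
  have e₄ : b.lam y V inf_le_left = X.left.presheaf.map (homOfLE (inf_le_left : V ≤ b.W y)).op (b.lam y (b.W y) le_rfl) :=
    (b.map_lam y le_rfl inf_le_left).symm
  rw [e₁, e₂, e₃, e₄, evalOrZero_map_homOfLE _ _ hPV, evalOrZero_map_homOfLE _ _ hPV, evalOrZero_map_homOfLE _ _ hPV,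
    evalOrZero_map_homOfLE _ _ hPV] at hrel
  exact hrel

variable [T2Space (ComplexPoints X)] [ParacompactSpace (ComplexPoints X)]

/-- **Cohomologous unit cocycles have the same topological first Chern class** (`Pic X = Ȟ¹(X, 𝒪_X^×)`, Hartshorne III Ex. 4.5, read on
`X(ℂ)`: restrict `c` to the refinement `W_x` (★ `lineChernClass_eq_of_refinement`), then rescale the charts by the units `λ_x(P)`
(★ `lineChernClass_eq_of_cohomologous`)). [cite: Hartshorne1977, III Ex. 4.5] [cite: HusemollerFibreBundles1994, Ch. 5 §3 Thm. 3.2] -/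
theorem _root_.Literature.AlgebraicGeometry.Modules.UnitCocycle.topChernClass_eq_of_coboundary (b : UnitCocycle.Coboundary c c') :
    c.topChernClass = c'.topChernClass := by
  have h₁ : lineChernClass (coboundaryCore b) = lineChernClass c.complexCore :=
    lineChernClass_eq_of_refinement (Z₁ := coboundaryCore b) (Z₂ := c.complexCore) (j := id) (fun x _ hP ↦ b.le x hP)
      fun _ _ _ _ ↦ rfl
  have h₂ : lineChernClass (coboundaryCore b) = lineChernClass c'.complexCore :=
    lineChernClass_eq_of_cohomologous (Z₁ := coboundaryCore b) (Z₂ := c'.complexCore) (j := id)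
      (h := fun x P ↦ evalOrZero (b.W x) (b.lam x (b.W x) le_rfl) P) (fun x _ hP ↦ b.le' x hP)
      (fun x ↦ continuousOn_evalOrZero (b.W x) _) (fun x _ hP ↦ evalOrZero_lam_ne_zero b x hP)
      fun x y P hP ↦ by
        rw [UnitCocycle.complexCore_coordChange_apply, mul_one]
        change _ = _ * (evalOrZero (c.U y ⊓ c.U x) (c.gInf y x) P * 1)
        rw [mul_one]
        exact evalOrZero_coboundary_rel b x y hP.1 hP.2
  rw [UnitCocycle.topChernClass_eq, UnitCocycle.topChernClass_eq, ← h₁, h₂]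

/-- Equivalent unit cocycles have the same class. [cite: Hartshorne1977, III Ex. 4.5] -/
theorem _root_.Literature.AlgebraicGeometry.Modules.UnitCocycle.topChernClass_eq_of_equiv (h : UnitCocycle.Equiv c c') :
    c.topChernClass = c'.topChernClass := by
  obtain ⟨b⟩ := h
  exact UnitCocycle.topChernClass_eq_of_coboundary b

variable (X) in
/-- **The topological first Chern class on `Ȟ¹(X, 𝒪_X^×)`**: `CechPic X → H²(X(ℂ); ℤ)` (Hartshorne III Ex. 4.5; well defined by
`topChernClass_eq_of_coboundary`). A deliberate dot-notation extension of `Modules.CechPic`. [cite: Hartshorne1977, III Ex. 4.5]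
[cite: HusemollerFibreBundles1994, Ch. 17 Def. 2.6] -/
def _root_.Literature.AlgebraicGeometry.Modules.CechPic.topChernClass :
    CechPic X.left → singularCohomology ℤ ℤ (ComplexPoints X) 2 :=
  Quotient.lift (s := UnitCocycle.setoid X.left) (fun c ↦ c.topChernClass) fun _ _ h ↦
    UnitCocycle.topChernClass_eq_of_equiv h

/-- The class of `[c]` is the class of `c`. [cite: Hartshorne1977, III Ex. 4.5] -/
@[simp]
theorem _root_.Literature.AlgebraicGeometry.Modules.CechPic.topChernClass_mk (c : UnitCocycle X.left) :
    CechPic.topChernClass X (CechPic.mk c) = c.topChernClass := rfl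

end Coboundary

/-! ### §3 The class of a finite locally free module (`c₁(det E)`; `c₁(E)` for a line bundle) -/

section Modules

variable {X : SchemeOver ℂ} [T2Space (ComplexPoints X)] [ParacompactSpace (ComplexPoints X)] {E E' : X.left.Modules}

/-- **`c₁(det E) ∈ H²(X(ℂ); ℤ)`** for a finite locally free `𝒪_X`-module `E` — for a LINE BUNDLE this is `c₁(E)`: the topological first
Chern class of the determinant class ★ `detClass hE ∈ Ȟ¹(X, 𝒪_X^×)` (Hartshorne II Ex. 6.11 / III Ex. 4.5).
[cite: Hartshorne1977, III Ex. 4.5] [cite: HusemollerFibreBundles1994, Ch. 17 Def. 2.6] -/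
def _root_.Literature.AlgebraicGeometry.Modules.detTopChernClass (hE : IsFiniteLocallyFree E) :
    singularCohomology ℤ ℤ (ComplexPoints X) 2 :=
  CechPic.topChernClass X (detClass hE)

/-- **The class can be computed in ANY frame system** (★ `detClass_eq_mk`). [cite: Hartshorne1977, III Ex. 4.5] -/
theorem _root_.Literature.AlgebraicGeometry.Modules.detTopChernClass_eq_of_frameSystem (hE : IsFiniteLocallyFree E)
    (F : FrameSystem E) : detTopChernClass hE = F.cocycle.topChernClass := by
  rw [detTopChernClass, detClass_eq_mk hE F, CechPic.topChernClass_mk]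

/-- The class does not depend on the local-freeness witness. [cite: Hartshorne1977, III Ex. 4.5] -/
theorem _root_.Literature.AlgebraicGeometry.Modules.detTopChernClass_congr (hE hE' : IsFiniteLocallyFree E) :
    detTopChernClass hE = detTopChernClass hE' := rfl

/-- **Isomorphic modules have the same class** (★ `detClass_eq_of_iso`). [cite: Hartshorne1977, III Ex. 4.5] -/
theorem _root_.Literature.AlgebraicGeometry.Modules.detTopChernClass_eq_of_iso (φ : E ≅ E') (hE : IsFiniteLocallyFree E)
    (hE' : IsFiniteLocallyFree E') : detTopChernClass hE = detTopChernClass hE' := by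
  rw [detTopChernClass, detTopChernClass, detClass_eq_of_iso φ hE hE']

/-- **The class of the line bundle glued from a unit cocycle is the class of the cocycle** (★ `detClass_lineBundle`).
[cite: Hartshorne1977, III Ex. 4.5] -/
theorem _root_.Literature.AlgebraicGeometry.Modules.detTopChernClass_lineBundle (c : UnitCocycle X.left) :
    detTopChernClass c.isFiniteLocallyFree_lineBundle = c.topChernClass := by
  rw [detTopChernClass, UnitCocycle.detClass_lineBundle, CechPic.topChernClass_mk]

end Modules

/-! ### §4 Naturality under pull-back along any morphism of `ℂ`-schemes -/

section Pullback

variable {X Y : SchemeOver ℂ} (f : Y ⟶ X) (c : UnitCocycle X.left)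

/-- The pulled-back unit cocycle `f^♯ g` read at a complex point `Q` of `Y` is `g` read at `f(Q)` (★ `evalOrZero_appLE`).
[cite: Hartshorne1977, II Ex. 6.8 (a)] -/
theorem _root_.Literature.AlgebraicGeometry.Modules.UnitCocycle.evalOrZero_gInf_pullback (x y : Y.left) {Q : ComplexPoints Y}
    (hx : Q.pt ∈ (UnitCocycle.pullback f.left c).U x) (hy : Q.pt ∈ (UnitCocycle.pullback f.left c).U y) :
    evalOrZero ((UnitCocycle.pullback f.left c).U x ⊓ (UnitCocycle.pullback f.left c).U y) ((UnitCocycle.pullback f.left c).gInf x y) Q =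
      evalOrZero (c.U (f.left.base x) ⊓ c.U (f.left.base y)) (c.gInf (f.left.base x) (f.left.base y)) (AlgPoints.map f Q) := by
  have hle : (UnitCocycle.pullback f.left c).U x ⊓ (UnitCocycle.pullback f.left c).U y ≤
      f.left ⁻¹ᵁ (c.U (f.left.base x) ⊓ c.U (f.left.base y)) := fun z hz ↦ hz
  change evalOrZero _ ((f.left.app _ ≫ Y.left.presheaf.map (homOfLE hle).op) (c.gInf (f.left.base x) (f.left.base y))) Q = _
  rw [CategoryTheory.comp_apply, evalOrZero_map_homOfLE hle _ (show Q.pt ∈ _ from ⟨hx, hy⟩), AlgPoints.evalOrZero_map]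

variable [T2Space (ComplexPoints X)] [ParacompactSpace (ComplexPoints X)] [T2Space (ComplexPoints Y)]
  [ParacompactSpace (ComplexPoints Y)]

/-- **Naturality of the topological first Chern class of unit cocycles: `c₁(f^*g) = H²(f(ℂ)) c₁(g)`** for every morphism `f : Y ⟶ X`
of `ℂ`-schemes (no dominance needed): the cocycle ★ `UnitCocycle.pullback f g` on `Y(ℂ)` refines, along the index map `y ↦ f y`, the
induced cocycle ★ `VectorBundleCore.pullbackCore` of `g` along `f(ℂ)` (★ `lineChernClass_eq_of_refinement`), whose class is
`H²(f(ℂ)) c₁(g)` (★ `lineChernClass_pullbackCore`). [cite: HusemollerFibreBundles1994, Ch. 17 Prop. 3.3] [cite: Hartshorne1977, II Ex. 6.8 (a)] -/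
theorem _root_.Literature.AlgebraicGeometry.Modules.UnitCocycle.topChernClass_pullback :
    (UnitCocycle.pullback f.left c).topChernClass =
      singularCohomology.map ℤ ℤ (AlgPoints.mapContinuous (L := ℂ) f) 2 c.topChernClass := by
  rw [UnitCocycle.topChernClass_eq, UnitCocycle.topChernClass_eq,
    ← lineChernClass_pullbackCore c.complexCore (AlgPoints.mapContinuous (L := ℂ) f)]
  refine lineChernClass_eq_of_refinement (Z₁ := (UnitCocycle.pullback f.left c).complexCore)
    (Z₂ := c.complexCore.pullbackCore (AlgPoints.mapContinuous (L := ℂ) f)) (j := f.left.base) (fun y Q hQ ↦ hQ) ?_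
  intro y y' Q hQ
  rw [UnitCocycle.complexCore_coordChange_apply, VectorBundleCore.pullbackCore_coordChange, UnitCocycle.complexCore_coordChange_apply,
    AlgPoints.mapContinuous_apply]
  exact congrArg (· * (1 : ℂ)) (UnitCocycle.evalOrZero_gInf_pullback f c y' y hQ.2 hQ.1)

/-- **Naturality on `Ȟ¹`: `c₁ ∘ f^* = H²(f(ℂ)) ∘ c₁`** (★ `CechPic.pullback`). [cite: Hartshorne1977, II Ex. 6.8 (a)]
[cite: HusemollerFibreBundles1994, Ch. 17 Prop. 3.3] -/
theorem _root_.Literature.AlgebraicGeometry.Modules.CechPic.topChernClass_pullback (a : CechPic X.left) :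
    CechPic.topChernClass Y (CechPic.pullback f.left a) =
      singularCohomology.map ℤ ℤ (AlgPoints.mapContinuous (L := ℂ) f) 2 (CechPic.topChernClass X a) := by
  obtain ⟨c, rfl⟩ := CechPic.mk_surjective a
  rw [CechPic.pullback_mk, CechPic.topChernClass_mk, CechPic.topChernClass_mk, UnitCocycle.topChernClass_pullback]

/-- **Naturality for modules: `c₁(det f^*E) = H²(f(ℂ)) c₁(det E)`** (★ `detClass_pullback`). [cite: Hartshorne1977, II Ex. 6.8 (a)]
[cite: HusemollerFibreBundles1994, Ch. 17 Prop. 3.3] -/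
theorem _root_.Literature.AlgebraicGeometry.Modules.detTopChernClass_pullback {E : X.left.Modules} (hE : IsFiniteLocallyFree E)
    (hE' : IsFiniteLocallyFree ((Scheme.Modules.pullback f.left).obj E)) :
    detTopChernClass hE' = singularCohomology.map ℤ ℤ (AlgPoints.mapContinuous (L := ℂ) f) 2 (detTopChernClass hE) := by
  rw [detTopChernClass, detTopChernClass, detClass_congr hE' (hE.pullback f.left), detClass_pullback,
    CechPic.topChernClass_pullback]

end Pullback

/-! ### §5 Junction with holomorphic line cocycles and `𝒪_X(D)^an` -/

section Holomorphic

open scoped Manifold ContDiff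
open Literature.Geometry.Kaehler

variable {ι : Type*} {E : Type*} [NormedAddCommGroup E] [NormedSpace ℂ E] {M : Type*} [TopologicalSpace M] [ChartedSpace E M]

/-- **A holomorphic line cocycle as a continuous `VectorBundleCore`** (charts `U_i`, transition `v ↦ g_ij(x) • v`; the distinguished
chart at `x` is chosen by `exists_mem_baseSet`). A deliberate dot-notation extension of `Kaehler.HolomorphicLineBundle`.
[cite: VoisinHodgeI2002, §3.3.1 and Thm. 4.49] -/
def _root_.Literature.Geometry.Kaehler.HolomorphicLineBundle.toCore (L : HolomorphicLineBundle ι E M) : VectorBundleCore ℂ M ℂ ι where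
  baseSet := L.baseSet
  isOpen_baseSet := L.isOpen_baseSet
  indexAt x := (L.exists_mem_baseSet x).choose
  mem_baseSet_at x := (L.exists_mem_baseSet x).choose_spec
  coordChange i j x := ContinuousLinearMap.lsmul ℂ ℂ (L.coordChange i j x)
  coordChange_self i x hx v := by rw [ContinuousLinearMap.lsmul_apply, L.coordChange_self i hx, one_smul]
  continuousOn_coordChange i j :=
    (ContinuousLinearMap.lsmul ℂ ℂ).continuous.comp_continuousOn (L.mdifferentiableOn_coordChange i j).continuousOn
  coordChange_comp i j k x hx v := by
    rw [ContinuousLinearMap.lsmul_apply, ContinuousLinearMap.lsmul_apply, ContinuousLinearMap.lsmul_apply, smul_smul,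
      mul_comm, L.coordChange_comp i j k x hx]

/-- The transition maps of `L.toCore`: multiplication by `g_ij(x)`. [cite: VoisinHodgeI2002, §3.3.1] -/
@[simp]
theorem _root_.Literature.Geometry.Kaehler.HolomorphicLineBundle.toCore_coordChange_apply (L : HolomorphicLineBundle ι E M)
    (i j : ι) (x : M) (v : ℂ) : L.toCore.coordChange i j x v = L.coordChange i j x * v := rfl

/-- The charts of `L.toCore` (definitional). [cite: VoisinHodgeI2002, §3.3.1] -/
@[simp]
theorem _root_.Literature.Geometry.Kaehler.HolomorphicLineBundle.toCore_baseSet (L : HolomorphicLineBundle ι E M) (i : ι) :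
    L.toCore.baseSet i = L.baseSet i := rfl

end Holomorphic

section CartierJunction

open scoped Manifold ContDiff
open Literature.Geometry.Kaehler Literature.NumberTheory.Transcendental

variable {X : SchemeOver ℂ} [IsIntegral X.left] {n : ℕ} {E : Type} [NormedAddCommGroup E] [NormedSpace ℂ E] [FiniteDimensional ℂ E]
  {M : Type} [TopologicalSpace M] [ChartedSpace E M] {φ : M → ComplexPoints X} (hφ : IsAnalytification E X n φ)
  (D : CartierDivisor X.left)

/-- **`𝒪_X(D)^an` as a continuous cocycle is a refinement of the induced cocycle of `D.toUnitCocycle` along `φ`**: same charts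
`φ⁻¹(U_{i(x)}(ℂ))` under the index map `x ↦ i(x)` (★ `CartierDivisor.chartIdx`) and the same transition functions `(f_{i(x)}/f_{i(y)})(φ m)`
(★ `CartierDivisor.toUnitCocycle_gInf`). [cite: SerreGAGA1956, §3 n°9] [cite: GortzWedhorn2020, Prop. 11.21 (p. 302)] -/
theorem cartierDivisorLineBundle_toCore_coordChange_eq (x y : X.left) {m : M} (hm : (φ m).pt ∈ D.toUnitCocycle.U x ⊓ D.toUnitCocycle.U y) :
    (cartierDivisorLineBundle hφ D).toCore.coordChange (D.chartIdx x) (D.chartIdx y) m 1 =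
      (D.toUnitCocycle.complexCore.pullbackCore ⟨φ, hφ.isHomeomorph.continuous⟩).coordChange x y m 1 := by
  rw [HolomorphicLineBundle.toCore_coordChange_apply, VectorBundleCore.pullbackCore_coordChange,
    UnitCocycle.complexCore_coordChange_apply, CartierDivisor.toUnitCocycle_gInf, ContinuousMap.coe_mk]
  change _ = evalOrZero (D.U (D.chartIdx y) ⊓ D.U (D.chartIdx x))
    (X.left.presheaf.map (homOfLE (le_refl (D.U (D.chartIdx y) ⊓ D.U (D.chartIdx x)))).op
      (D.transFun (D.chartIdx y) (D.chartIdx x))) (φ m) * 1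
  rw [evalOrZero_map_homOfLE (le_refl _) _ (show (φ m).pt ∈ D.U (D.chartIdx y) ⊓ D.U (D.chartIdx x) from ⟨hm.2, hm.1⟩)]
  rfl

variable [T2Space M] [ParacompactSpace M] [T2Space (ComplexPoints X)] [ParacompactSpace (ComplexPoints X)]

/-- **`c₁((𝒪_X(D)^an).toCore) = H²(φ) c₁(D.toUnitCocycle)`** on an analytification `φ : M → X(ℂ)` (e.g. a torus uniformisation of an
abelian variety): refinement (★ `lineChernClass_eq_of_refinement`) + induced cocycle (★ `lineChernClass_pullbackCore`). This is the
class from which the torus-side computation «`c₁(L(H, χ)) = E`» starts. [cite: HusemollerFibreBundles1994, Ch. 17 Prop. 3.3]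
[cite: SerreGAGA1956, §3 n°9] -/
theorem lineChernClass_toCore_cartierDivisorLineBundle :
    lineChernClass (cartierDivisorLineBundle hφ D).toCore =
      singularCohomology.map ℤ ℤ (⟨φ, hφ.isHomeomorph.continuous⟩ : C(M, ComplexPoints X)) 2 D.toUnitCocycle.topChernClass := by
  rw [UnitCocycle.topChernClass_eq, ← lineChernClass_pullbackCore D.toUnitCocycle.complexCore ⟨φ, hφ.isHomeomorph.continuous⟩]
  symm
  refine lineChernClass_eq_of_refinement (Z₁ := D.toUnitCocycle.complexCore.pullbackCore ⟨φ, hφ.isHomeomorph.continuous⟩)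
    (Z₂ := (cartierDivisorLineBundle hφ D).toCore) (j := D.chartIdx) (fun x m hm ↦ hm) ?_
  intro x y m hm
  exact (cartierDivisorLineBundle_toCore_coordChange_eq hφ D x y hm).symm

end CartierJunction

end Literature.AlgebraicGeometry.HodgeTheory

end
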